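import Mathlib

/-!
# Route LevelSetModeration — `LevelSetEnergyInequality`: truncation calculus (helper file 1)

Support lemmas for item stmt-NavierStokesRegularity-18151 (Vasseur's level-set energy inequality
for the speed, Vasseur 2007 Lemma 11 globalised). Pure calculus on `ℝ³ = EuclideanSpace ℝ (Fin 3)`:

* the speed truncation weight `k₀(v) = (|v| - c)₊ / max(|v|, c)` (`= (1 - c/|v|)₊` off `v = 0`,
  continuous) and the truncated energy density `Ψ(v) = (|v| - c)₊²`, which is `C¹` with
  `DΨ(v) = 2 k₀(v) ⟪v, ·⟫`;
* a sequence of smooth regularisations `hₙ` of the identity vanishing near `0`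
  (`hₙ(y) = (y - εₙ) ρ(y/εₙ - 1)`, `ρ = Real.smoothTransition`, `εₙ = 1/(n+1)`), used to smooth
  `k₀` in the viscous term;
* the bound `‖D|u|(x)‖² ≤ Σᵢ ⟪u, ∂ᵢu⟫² / |u|²` for the derivative of the speed.

## References
* A. F. Vasseur, *A new proof of partial regularity of solutions to Navier–Stokes equations*,
  NoDEA 14 (2007), Lemma 11 and (12). [Vasseur2007]
-/

noncomputable section

-- single-conjunct summit: `Summit.<Summit>.<Problem>` repeats the name by the D-0017 layout
set_option linter.dupNamespace false

namespace Summit.NavierStokesRegularity.NavierStokesRegularity.Theorems.LevelSetEnergyInequality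

open Real Set Filter Topology
open scoped RealInnerProductSpace

/-! ### A real-variable lemma: `s ↦ (s - c)₊²` is differentiable -/

/-- `d/ds (s - c)₊² = 2 (s - c)₊` everywhere (at the kink `s = c` the square kills the corner). -/
theorem hasDerivAt_posPart_sub_sq (c s : ℝ) :
    HasDerivAt (fun s => (max (s - c) 0) ^ 2) (2 * max (s - c) 0) s := by
  rcases lt_trichotomy s c with hs | rfl | hs
  · -- locally zero
    have hev : (fun s => (max (s - c) 0) ^ 2) =ᶠ[𝓝 s] fun _ => (0 : ℝ) := by
      filter_upwards [Iio_mem_nhds hs] with r hr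
      rw [max_eq_right (by linarith [mem_Iio.1 hr]), zero_pow two_ne_zero]
    rw [max_eq_right (by linarith), mul_zero]
    exact (hasDerivAt_const s (0 : ℝ)).congr_of_eventuallyEq hev
  · -- the kink: the function is `o(r - c)`
    rw [sub_self, max_self, mul_zero]
    rw [hasDerivAt_iff_isLittleO]
    simp only [sub_self, max_self, zero_pow two_ne_zero, sub_zero, smul_zero]
    refine Asymptotics.isLittleO_iff.2 fun ε hε => ?_
    filter_upwards [Metric.ball_mem_nhds s hε] with r hr
    rw [Metric.mem_ball, dist_eq_norm, Real.norm_eq_abs] at hr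
    have h1 : |max (r - s) 0| ≤ |r - s| := by
      rw [abs_of_nonneg (le_max_right _ _)]
      exact max_le (le_abs_self _) (abs_nonneg _)
    rw [Real.norm_eq_abs, Real.norm_eq_abs, abs_pow]
    calc |max (r - s) 0| ^ 2 ≤ |r - s| ^ 2 := pow_le_pow_left₀ (abs_nonneg _) h1 2
      _ = |r - s| * |r - s| := sq _
      _ ≤ ε * |r - s| := mul_le_mul_of_nonneg_right hr.le (abs_nonneg _)
  · -- locally `(r - c)²`
    have hev : (fun s => (max (s - c) 0) ^ 2) =ᶠ[𝓝 s] fun r => (r - c) ^ 2 := by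
      filter_upwards [Ioi_mem_nhds hs] with r hr
      rw [max_eq_left (by linarith [mem_Ioi.1 hr])]
    rw [max_eq_left (by linarith)]
    have h := ((hasDerivAt_id s).sub_const c).pow 2
    simp only [Nat.cast_ofNat, Nat.add_one_sub_one, pow_one, id, mul_one] at h
    exact h.congr_of_eventuallyEq hev

/-! ### The truncation weight `k₀` and the truncated energy `Ψ` on `ℝ³` -/

variable {c : ℝ}

/-- The weight `k₀(v) = (|v|-c)₊ / max(|v|, c)` is continuous for `c > 0`. -/
theorem continuous_weight (hc : 0 < c) :
    Continuous fun v : EuclideanSpace ℝ (Fin 3) => max (‖v‖ - c) 0 / max ‖v‖ c := by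
  refine Continuous.div (by fun_prop) (by fun_prop) fun v => ?_
  exact (lt_of_lt_of_le hc (le_max_right _ _)).ne'

/-- `0 ≤ k₀(v)`. -/
theorem weight_nonneg (hc : 0 < c) (v : EuclideanSpace ℝ (Fin 3)) :
    0 ≤ max (‖v‖ - c) 0 / max ‖v‖ c :=
  div_nonneg (le_max_right _ _) (hc.le.trans (le_max_right _ _))

/-- `k₀(v) ≤ 1`. -/
theorem weight_le_one (hc : 0 < c) (v : EuclideanSpace ℝ (Fin 3)) :
    max (‖v‖ - c) 0 / max ‖v‖ c ≤ 1 := by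
  rw [div_le_one (lt_of_lt_of_le hc (le_max_right _ _))]
  exact max_le (by linarith [le_max_left ‖v‖ c]) (hc.le.trans (le_max_right _ _))

/-- Off the super-level set the weight vanishes: `|v| ≤ c ⇒ k₀(v) = 0`. -/
theorem weight_eq_zero_of_norm_le (v : EuclideanSpace ℝ (Fin 3)) (hv : ‖v‖ ≤ c) :
    max (‖v‖ - c) 0 / max ‖v‖ c = 0 := by
  rw [max_eq_right (by linarith), zero_div]

/-- On the super-level set, `k₀(v) = 1 - c/|v|`. -/
theorem weight_eq_of_le_norm (hc : 0 < c) (v : EuclideanSpace ℝ (Fin 3)) (hv : c ≤ ‖v‖) :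
    max (‖v‖ - c) 0 / max ‖v‖ c = 1 - c / ‖v‖ := by
  have hv0 : 0 < ‖v‖ := hc.trans_le hv
  rw [max_eq_left (by linarith), max_eq_left hv]
  field_simp

/-- `k₀(v) = 0 ↔ |v| ≤ c`. -/
theorem weight_pos_iff (hc : 0 < c) (v : EuclideanSpace ℝ (Fin 3)) :
    0 < max (‖v‖ - c) 0 / max ‖v‖ c ↔ c < ‖v‖ := by
  constructor
  · intro h
    by_contra hle
    rw [weight_eq_zero_of_norm_le v (not_lt.1 hle)] at h
    exact lt_irrefl _ h
  · intro h
    exact div_pos (lt_max_of_lt_left (by linarith)) (lt_of_lt_of_le hc (le_max_right _ _))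

/-- `c / max(|v|, c) = 1 - k₀(v)`. -/
theorem div_max_eq_one_sub_weight (hc : 0 < c) (v : EuclideanSpace ℝ (Fin 3)) :
    c / max ‖v‖ c = 1 - max (‖v‖ - c) 0 / max ‖v‖ c := by
  rcases le_or_gt c ‖v‖ with h | h
  · rw [weight_eq_of_le_norm hc v h, max_eq_left h]; ring
  · rw [weight_eq_zero_of_norm_le v h.le, max_eq_right h.le, div_self hc.ne']; ring

/-- The weight against anything vanishing at `v = 0` is the printed `(1 - c/|v|)₊`:
`k₀(v) a = max(1 - c/|v|, 0) a` whenever `v = 0 → a = 0` (at `v = 0` Lean's `c/0 = 0` makes the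
printed weight `1`, harmlessly). -/
theorem weight_mul_eq_posPart_mul (hc : 0 < c) (v : EuclideanSpace ℝ (Fin 3)) {a : ℝ}
    (ha : v = 0 → a = 0) :
    max (‖v‖ - c) 0 / max ‖v‖ c * a = max (1 - c / ‖v‖) 0 * a := by
  rcases eq_or_ne v 0 with hv | hv
  · rw [ha hv, mul_zero, mul_zero]
  · have hv0 : 0 < ‖v‖ := norm_pos_iff.2 hv
    rcases le_or_gt c ‖v‖ with h | h
    · rw [weight_eq_of_le_norm hc v h, max_eq_left]
      rw [sub_nonneg, div_le_one hv0]
      exact h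
    · rw [weight_eq_zero_of_norm_le v h.le, max_eq_right]
      rw [sub_nonpos, one_le_div hv0]
      exact h.le

/-- The derivative of the norm at a nonzero point of `ℝ³`: `D|·|(v) = |v|⁻¹ ⟪v, ·⟫`. -/
theorem hasFDerivAt_norm_of_ne_zero {v : EuclideanSpace ℝ (Fin 3)} (hv : v ≠ 0) :
    HasFDerivAt (fun w : EuclideanSpace ℝ (Fin 3) => ‖w‖) (‖v‖⁻¹ • innerSL ℝ v) v := by
  have hv0 : 0 < ‖v‖ := norm_pos_iff.2 hv
  have h1 : HasFDerivAt (fun w : EuclideanSpace ℝ (Fin 3) => ‖w‖ ^ 2) ((2 : ℝ) • innerSL ℝ v) v := by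
    have := (hasStrictFDerivAt_norm_sq v).hasFDerivAt
    simpa [two_smul] using this
  have h2 := h1.sqrt (pow_ne_zero 2 hv0.ne')
  have hfun : (fun w : EuclideanSpace ℝ (Fin 3) => √(‖w‖ ^ 2)) = fun w => ‖w‖ :=
    funext fun w => Real.sqrt_sq (norm_nonneg w)
  rw [hfun, Real.sqrt_sq hv0.le] at h2
  have heq : (1 / (2 * ‖v‖)) • (2 : ℝ) • innerSL ℝ v = ‖v‖⁻¹ • innerSL ℝ v := by
    rw [smul_smul]
    congr 1
    field_simp
  rw [heq] at h2
  exact h2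

/-- **`Ψ(v) = (|v| - c)₊²` is differentiable with `DΨ(v) = 2 k₀(v) ⟪v, ·⟫`** (`c > 0`). -/
theorem hasFDerivAt_truncSq (hc : 0 < c) (v : EuclideanSpace ℝ (Fin 3)) :
    HasFDerivAt (fun w : EuclideanSpace ℝ (Fin 3) => (max (‖w‖ - c) 0) ^ 2)
      ((2 * (max (‖v‖ - c) 0 / max ‖v‖ c)) • innerSL ℝ v) v := by
  rcases lt_or_ge ‖v‖ c with hv | hv
  · -- locally zero
    have hev : (fun w : EuclideanSpace ℝ (Fin 3) => (max (‖w‖ - c) 0) ^ 2) =ᶠ[𝓝 v]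
        fun _ => (0 : ℝ) := by
      have ho : IsOpen {w : EuclideanSpace ℝ (Fin 3) | ‖w‖ < c} :=
        isOpen_lt continuous_norm continuous_const
      filter_upwards [ho.mem_nhds hv] with w hw
      rw [max_eq_right (by linarith [show ‖w‖ < c from hw]), zero_pow two_ne_zero]
    rw [weight_eq_zero_of_norm_le v hv.le, mul_zero, zero_smul]
    exact (hasFDerivAt_const (0 : ℝ) v).congr_of_eventuallyEq hev
  · have hv0 : v ≠ 0 := by
      intro h; rw [h, norm_zero] at hv; linarith
    have hvpos : 0 < ‖v‖ := norm_pos_iff.2 hv0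
    have h := (hasDerivAt_posPart_sub_sq c ‖v‖).comp_hasFDerivAt v (hasFDerivAt_norm_of_ne_zero hv0)
    have heq : (2 * max (‖v‖ - c) 0) • ‖v‖⁻¹ • innerSL ℝ v =
        (2 * (max (‖v‖ - c) 0 / max ‖v‖ c)) • innerSL ℝ v := by
      rw [smul_smul, max_eq_left hv]
      congr 1
      field_simp
    rw [heq] at h
    exact h

/-- `Ψ` is differentiable. -/
theorem differentiable_truncSq (hc : 0 < c) :
    Differentiable ℝ fun w : EuclideanSpace ℝ (Fin 3) => (max (‖w‖ - c) 0) ^ 2 :=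
  fun v => (hasFDerivAt_truncSq hc v).differentiableAt

/-- The derivative of `Ψ`. -/
theorem fderiv_truncSq (hc : 0 < c) (v : EuclideanSpace ℝ (Fin 3)) :
    fderiv ℝ (fun w : EuclideanSpace ℝ (Fin 3) => (max (‖w‖ - c) 0) ^ 2) v =
      (2 * (max (‖v‖ - c) 0 / max ‖v‖ c)) • innerSL ℝ v :=
  (hasFDerivAt_truncSq hc v).fderiv

/-- `Ψ` is `C¹` (its derivative `v ↦ 2k₀(v)⟪v,·⟫` is continuous). -/
theorem contDiff_one_truncSq (hc : 0 < c) :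
    ContDiff ℝ 1 fun w : EuclideanSpace ℝ (Fin 3) => (max (‖w‖ - c) 0) ^ 2 := by
  rw [contDiff_one_iff_fderiv]
  refine ⟨differentiable_truncSq hc, ?_⟩
  have : fderiv ℝ (fun w : EuclideanSpace ℝ (Fin 3) => (max (‖w‖ - c) 0) ^ 2) =
      fun v => (2 * (max (‖v‖ - c) 0 / max ‖v‖ c)) • innerSL ℝ v :=
    funext (fderiv_truncSq hc)
  rw [this]
  exact ((continuous_const.mul (continuous_weight hc)).smul (innerSL ℝ).continuous)

/-- `0 ≤ Ψ(v) ≤ |v|²`. -/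
theorem truncSq_le_norm_sq (hc : 0 < c) (v : EuclideanSpace ℝ (Fin 3)) :
    (max (‖v‖ - c) 0) ^ 2 ≤ ‖v‖ ^ 2 := by
  refine pow_le_pow_left₀ (le_max_right _ _) (max_le (by linarith) (norm_nonneg _)) 2

/-- `Ψ(v) = 0` when `|v| ≤ c`. -/
theorem truncSq_eq_zero_of_norm_le (v : EuclideanSpace ℝ (Fin 3)) (hv : ‖v‖ ≤ c) :
    (max (‖v‖ - c) 0) ^ 2 = 0 := by
  rw [max_eq_right (by linarith), zero_pow two_ne_zero]

/-! ### The derivative of the speed is bounded by `Σᵢ ⟪u, ∂ᵢu⟫² / |u|²` -/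

/-- **`‖D|u|(x)‖² ≤ Σᵢ ⟪u(x), ∂ᵢu(x)⟫² / |u(x)|²`** at points where `u(x) ≠ 0` (for `u`
differentiable at `x`): `D|u|(x) w = |u|⁻¹ ⟪u, Du w⟫ = |u|⁻¹ Σᵢ wᵢ ⟪u, ∂ᵢu⟫` and Cauchy–Schwarz in
`Σᵢ`. -/
theorem norm_fderiv_norm_sq_le {u : EuclideanSpace ℝ (Fin 3) → EuclideanSpace ℝ (Fin 3)}
    {x : EuclideanSpace ℝ (Fin 3)} (hu : DifferentiableAt ℝ u x) (hx : u x ≠ 0) :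
    ‖fderiv ℝ (fun y => ‖u y‖) x‖ ^ 2 ≤
      (∑ i, ⟪u x, fderiv ℝ u x (EuclideanSpace.basisFun (Fin 3) ℝ i)⟫ ^ 2) / ‖u x‖ ^ 2 := by
  set e := EuclideanSpace.basisFun (Fin 3) ℝ with he
  set S : ℝ := ∑ i, ⟪u x, fderiv ℝ u x (e i)⟫ ^ 2 with hS
  have hS0 : 0 ≤ S := Finset.sum_nonneg fun i _ => sq_nonneg _
  have hux : 0 < ‖u x‖ := norm_pos_iff.2 hx
  have hD : HasFDerivAt (fun y => ‖u y‖) ((‖u x‖⁻¹ • innerSL ℝ (u x)).comp (fderiv ℝ u x)) x :=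
    (hasFDerivAt_norm_of_ne_zero hx).comp x hu.hasFDerivAt
  rw [hD.fderiv]
  -- bound the operator norm by `√S / |u|`
  have hbound : ‖(‖u x‖⁻¹ • innerSL ℝ (u x)).comp (fderiv ℝ u x)‖ ≤ Real.sqrt S / ‖u x‖ := by
    refine ContinuousLinearMap.opNorm_le_bound _ (by positivity) fun w => ?_
    have hw : fderiv ℝ u x w = ∑ i, w i • fderiv ℝ u x (e i) := by
      conv_lhs => rw [← e.sum_repr w]
      simp [map_sum, map_smul, he]
    have hinner : ⟪u x, fderiv ℝ u x w⟫ = ∑ i, w i * ⟪u x, fderiv ℝ u x (e i)⟫ := by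
      rw [hw, inner_sum]
      simp [inner_smul_right]
    have hCS : (∑ i, w i * ⟪u x, fderiv ℝ u x (e i)⟫) ^ 2 ≤
        (∑ i, w i ^ 2) * ∑ i, ⟪u x, fderiv ℝ u x (e i)⟫ ^ 2 :=
      Finset.sum_mul_sq_le_sq_mul_sq _ _ _
    have hwn : ∑ i, w i ^ 2 = ‖w‖ ^ 2 := by
      rw [EuclideanSpace.norm_sq_eq]
      simp [Real.norm_eq_abs, sq_abs]
    rw [hwn, ← hS] at hCS
    have habs : |∑ i, w i * ⟪u x, fderiv ℝ u x (e i)⟫| ≤ ‖w‖ * Real.sqrt S := by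
      have h1 : |∑ i, w i * ⟪u x, fderiv ℝ u x (e i)⟫| ^ 2 ≤ (‖w‖ * Real.sqrt S) ^ 2 := by
        rw [sq_abs, mul_pow, Real.sq_sqrt hS0]; exact hCS
      exact abs_le_of_sq_le_sq' h1 (by positivity) |>.2
    calc ‖((‖u x‖⁻¹ • innerSL ℝ (u x)).comp (fderiv ℝ u x)) w‖
        = ‖u x‖⁻¹ * |⟪u x, fderiv ℝ u x w⟫| := by
          rw [ContinuousLinearMap.comp_apply, FunLike.coe_smul, Pi.smul_apply, innerSL_apply_apply,
            smul_eq_mul, norm_mul, norm_inv, norm_norm, Real.norm_eq_abs]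
      _ ≤ ‖u x‖⁻¹ * (‖w‖ * Real.sqrt S) := by
          rw [hinner]; exact mul_le_mul_of_nonneg_left habs (by positivity)
      _ = Real.sqrt S / ‖u x‖ * ‖w‖ := by ring
  have h0 : 0 ≤ ‖(‖u x‖⁻¹ • innerSL ℝ (u x)).comp (fderiv ℝ u x)‖ := norm_nonneg _
  calc ‖(‖u x‖⁻¹ • innerSL ℝ (u x)).comp (fderiv ℝ u x)‖ ^ 2 ≤ (Real.sqrt S / ‖u x‖) ^ 2 :=
        pow_le_pow_left₀ h0 hbound 2
    _ = S / ‖u x‖ ^ 2 := by rw [div_pow, Real.sq_sqrt hS0]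

end Summit.NavierStokesRegularity.NavierStokesRegularity.Theorems.LevelSetEnergyInequality

end
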